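import Summits.BirchSwinnertonDyer.BirchSwinnertonDyer.Theses.PrintX9
import Literature.NumberTheory.EllipticCurves.AnalyticRankModularityProofs
import Literature.NumberTheory.EllipticCurves.ModularParametrizationTrustBaseProofs
import Literature.NumberTheory.EllipticCurves.ModularParametrizationDegreeHoldsProofs
import Literature.NumberTheory.EllipticCurves.ModularParametrizationBCDTProofs
import Literature.NumberTheory.EllipticCurves.SkinnerUrban2014.PAdicUnitPeriodRatioProofs
import HarnessLib

/-!
# Route `PrintX9`, support item `CyclotomicPrintFactsX9` (stmt-BirchSwinnertonDyer-20532): the SLIMMED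
# dependency list — the six-conjunct cyclotomic/modularity pack from its irredundant inputs

D-0154 (2) INPUTS→UNCONDITIONAL, `INPUTS-LIST-2.md` §4 T1 «PackSlim» (cell `pub/bsd-wall`, seat
`bsd-inputs-pack-p1`). `CyclotomicPrintFactsX9` is the conjunction of six published facts: BCS 2025
Thm 1.1.2 (a) (`BCSCharIdealEqPadicLFunction`, 19459), Greenberg LNM 1716 Thm 4.1
(`GreenbergCharValueRankZero`, 19460), Gross–Zagier–Kolyvagin (`RankEqAnalyticRankLeOne`, 19921),
entireness of `L(E,s)` (`EntireLFunctionRat`, 19273), modular parametrisation data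
(`ModularParametrizationSupply`, 19266), the period unit `Ω_E = u · Ω⁺_f` at good `p ≥ 5`
(`RealPeriodUnitPlusPeriod`, 19290). Over the tree's LANDED theorems, three conjuncts are redundant
given two items the SAME route already displays in its Heegner pack (20530): the newform
(`NewformExistence`, 19382) gives the entire continuation
(`WeierstrassCurve.hasEntireLFunction_rat_of_exists_isNewformOf`) and the parametrisation datum
(`ModularForms.nonempty_modularParametrizationData_of_exists_isNewformOf` with the DISCHARGED Manin
constant `ModularForms.IsNewformOf.exists_maninConstant_ne_zero_holds`), and Mazur 1978 Cor. 4.1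
(`MazurManinConstantOdd`, 19383) gives the period unit
(`SkinnerUrban2014.realPeriodRat_eq_unit_mul_plusPeriod_of_mazur`).

Theorems: `cyclotomicPrintFactsX9_of_slim` (6 → 5, all registered items: BCS, Greenberg, GZK, newform,
Mazur — of which only the first three are new beside the Heegner pack); `cyclotomicPrintFactsX9_of_slim_param`
(6 → 5 in the pack's own vocabulary, dropping only the entire continuation); the in-route edges
`printX9_entireLFunctionRat_of_newformExistence`, `printX9_modularParametrizationSupply_of_newformExistence`,
`printX9_newformExistence_of_modularParametrizationSupply`,
`printX9_realPeriodUnitPlusPeriod_of_mazurManinConstantOdd`. Together with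
`PrintX9HeegnerPrintFactsX9Slim.lean` the two X9 print packs (18 displayed conjunct slots) rest on
ELEVEN inputs. HONEST FRAMING: pure glue over landed theorems; no cite-only fact is proved here; the
remaining inputs stay print hypotheses and the route stays conditional on them AS TYPED. Nothing here
proves BSD; BSD is not proved by any of this.
-/

set_option autoImplicit false
set_option linter.dupNamespace false

namespace Summit.BirchSwinnertonDyer.BirchSwinnertonDyer.Theorems

open Literature.NumberTheory.EllipticCurves
open Summit.BirchSwinnertonDyer.BirchSwinnertonDyer.Theses.PrintX9

/-- In-route edge: the newform item `NewformExistence` (19382) gives `EntireLFunctionRat` (19273), by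
`WeierstrassCurve.hasEntireLFunction_rat_of_exists_isNewformOf`. [folklore] -/
theorem printX9_entireLFunctionRat_of_newformExistence (hmod : NewformExistence) :
    Summit.BirchSwinnertonDyer.BirchSwinnertonDyer.Theses.PrintX9.EntireLFunctionRat :=
  WeierstrassCurve.hasEntireLFunction_rat_of_exists_isNewformOf hmod

/-- In-route edge: `NewformExistence` (19382) gives `ModularParametrizationSupply` (19266), by
`ModularForms.nonempty_modularParametrizationData_of_exists_isNewformOf` with the discharged rational
Manin constant `ModularForms.IsNewformOf.exists_maninConstant_ne_zero_holds` (BCDT 2001 p. 845,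
(2) ⇒ (6): Shimura's construction + Faltings). [folklore] -/
theorem printX9_modularParametrizationSupply_of_newformExistence (hmod : NewformExistence) :
    Summit.BirchSwinnertonDyer.BirchSwinnertonDyer.Theses.PrintX9.ModularParametrizationSupply :=
  ModularForms.nonempty_modularParametrizationData_of_exists_isNewformOf hmod
    ModularForms.IsNewformOf.exists_maninConstant_ne_zero_holds

/-- In-route edge, converse direction: `ModularParametrizationSupply` (19266) gives `NewformExistence`
(19382), by `ModularForms.exists_isNewformOf_of_nonempty_modularParametrizationData` (BCDT 2001 p. 845,
(6) ⇒ (2)). [folklore] -/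
theorem printX9_newformExistence_of_modularParametrizationSupply (hparam : ModularParametrizationSupply) :
    Summit.BirchSwinnertonDyer.BirchSwinnertonDyer.Theses.PrintX9.NewformExistence :=
  ModularForms.exists_isNewformOf_of_nonempty_modularParametrizationData hparam

/-- In-route edge: Mazur 1978 Cor. 4.1 (`MazurManinConstantOdd`, 19383) gives the period unit at good
`p ≥ 5` (`RealPeriodUnitPlusPeriod`, 19290), by
`SkinnerUrban2014.realPeriodRat_eq_unit_mul_plusPeriod_of_mazur`. [folklore] -/
theorem printX9_realPeriodUnitPlusPeriod_of_mazurManinConstantOdd (hMazur : MazurManinConstantOdd) :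
    Summit.BirchSwinnertonDyer.BirchSwinnertonDyer.Theses.PrintX9.RealPeriodUnitPlusPeriod :=
  SkinnerUrban2014.realPeriodRat_eq_unit_mul_plusPeriod_of_mazur hMazur

/-- **`CyclotomicPrintFactsX9` from five registered items** (route `PrintX9`, item
stmt-BirchSwinnertonDyer-20532; INPUTS-LIST-2 T1): BCS 2025 Thm 1.1.2 (a), Greenberg Thm 4.1, GZK,
plus the newform (`NewformExistence`) and Mazur Cor. 4.1 (`MazurManinConstantOdd`) which the route's
Heegner pack 20530 already displays — conjuncts 4, 5, 6 (entire continuation, parametrisation datum,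
period unit) being the tree theorems named in the edges above. Pure glue; the five hypotheses remain
print inputs. [folklore] -/
theorem cyclotomicPrintFactsX9_of_slim
    (hBCS : BCSCharIdealEqPadicLFunction) (hGr : GreenbergCharValueRankZero)
    (hGZK : RankEqAnalyticRankLeOne) (hmod : NewformExistence) (hMazur : MazurManinConstantOdd) :
    Summit.BirchSwinnertonDyer.BirchSwinnertonDyer.Theses.PrintX9.CyclotomicPrintFactsX9 :=
  ⟨hBCS, hGr, hGZK, printX9_entireLFunctionRat_of_newformExistence hmod,
    printX9_modularParametrizationSupply_of_newformExistence hmod,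
    printX9_realPeriodUnitPlusPeriod_of_mazurManinConstantOdd hMazur⟩

/-- **`CyclotomicPrintFactsX9` from five of its own six items** (drop only the entire continuation,
19273, recovered from `ModularParametrizationSupply` through the newform). Pure glue. [folklore] -/
theorem cyclotomicPrintFactsX9_of_slim_param
    (hBCS : BCSCharIdealEqPadicLFunction) (hGr : GreenbergCharValueRankZero)
    (hGZK : RankEqAnalyticRankLeOne) (hparam : ModularParametrizationSupply)
    (hPer : RealPeriodUnitPlusPeriod) :
    Summit.BirchSwinnertonDyer.BirchSwinnertonDyer.Theses.PrintX9.CyclotomicPrintFactsX9 :=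
  ⟨hBCS, hGr, hGZK,
    printX9_entireLFunctionRat_of_newformExistence
      (printX9_newformExistence_of_modularParametrizationSupply hparam),
    hparam, hPer⟩

end Summit.BirchSwinnertonDyer.BirchSwinnertonDyer.Theorems
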